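import Summits.BirchSwinnertonDyer.BirchSwinnertonDyer.Theorems.KatoDescentPotSupersingularKatoFiniteLevelStrictBounds
import Summits.BirchSwinnertonDyer.Rank1Residual.X11b.LevelLiftingLower
import HarnessLib

/-!
# Kato's (14.9.3) at finite level, part 6: the exact count FOR ALL LARGE LEVELS with the exponent of
# `Sel_str^{ur}` and the unramifiedness of `E[p^k]` DISCHARGED —
# `∃ k₀, ∀ k ≥ k₀: #H¹(O_K[1/p], E[p^k]) = #Sel_str^{ur}(K, E[p^∞]) · ∏_{v∣p} #𝓚_v`
# (route `KatoDescentPotSupersingular` / `…Tame…`, crux M = stmt-BirchSwinnertonDyer-19196; route-free helper)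

Seat `bsd-potss-rkm` g17 (prover; cell `bsd-potss`), item stmt-BirchSwinnertonDyer-19196 `ReducibleKatoMember`
(`--supports … --as helper`; closes nothing).  HONEST FRAMING: BSD is not proved by any of this; nothing is booked;
theorems only (no definition, no named fact).  Sequel of `…KatoFiniteLevelStrictBounds`.

## What

**`exists_forall_le_natCard_selmerGroup_relaxed_eq`** — for an elliptic curve over a number field `K : Type`, an odd prime
`p`, finite sets `P ⊆ T` of finite places with `P ⊇ {v ∣ p}` and `T ⊇` the bad places, and Kato's strict structure `𝓢∞`
on `E[p^∞]` (zero at `P`, UNRAMIFIED at every other finite place) with `Sel_str^{ur}(K,E[p^∞]) = H¹_{𝓢∞}` FINITE: granted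
only that the local torsion `E(K_v)[p^∞]` (`v ∈ P`) is killed by some `p^{e_P}` (finite local torsion, theorem-shaped),
there is `k₀` such that for every `k ≥ k₀`, every Poitou–Tate family at level `p^k` and every pair of Kato structures
`𝓢 ≤ ℛ` on `E[p^k]` (zero / everything at `P`, unramified at every finite `v ∉ P`):
`#H¹_ℛ(K, E[p^k]) = #Sel_str^{ur}(K, E[p^∞]) · ∏_{v∈P} #𝓚_v`.
Discharged here: the exponent `p^m` of the finite group `Sel_str^{ur}` (X11b `AcSelmer.exists_pow_nsmul_eq_zero_of_finite`:
every class of `H¹(K, E[p^∞])` is `p`-power torsion), the unramifiedness of `E[p^k]` off `T`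
(`AcSelmer.isUnramifiedAt_torsionGaloisModule`, Silverman VII.4.1), `{v ∣ p^k} = {v ∣ p} ⊆ P`, and the bound (hN) (part 5).
Over `ℚ`, `P = {p}`: **`#H¹(ℤ[1/p], E[p^k]) = #Sel_str^{ur}(ℚ, E[p^∞]) · #E(ℚ_p)[p^∞] · p^k` for all `k ≫ 0`** — Kato's
(14.9.3)/(14.16.2) count with the strict side passed to `E[p^∞]` (= `Ker(H²(ℤ[1/p],T) → H²(ℚ_p,T))^∨` by (14.9.3)–(14.9.4)).

References: K. Kato, Astérisque 295 (2004) (14.9.3)–(14.9.4), Prop. 14.16 [Kato2004Asterisque]; J. H. Silverman, *AEC*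
VII.4.1 [SilvermanAEC2009]; R. Greenberg, LNM 1716 §3, §5 [GreenbergLNM1716].
-/

-- the summit and its single problem are both named `BirchSwinnertonDyer` (registry layout D-0017)
set_option linter.dupNamespace false
set_option autoImplicit false

noncomputable section

open scoped Classical ContRepresentation NumberField
open Function Field NumberField IsDedekindDomain WeierstrassCurve
open Literature.NumberTheory.EllipticCurves Literature.NumberTheory.GaloisRepresentations
  Literature.NumberTheory.GaloisRepresentations.DiscreteGaloisModule Literature.NumberTheory.GaloisCohomology
open Summit.BirchSwinnertonDyer.Rank1Residual.X11b.Levels Summit.BirchSwinnertonDyer.Rank1Residual.X11b.LocBridge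
open Summit.BirchSwinnertonDyer.Rank1Residual.X11b.AcSelmer
open Summit.BirchSwinnertonDyer.Rank1Residual.GaloisImage

namespace Summit.BirchSwinnertonDyer.BirchSwinnertonDyer.Theorems.KatoFiniteLevelCount

section Final

variable {K : Type} [Field K] [NumberField K] (W : WeierstrassCurve K) [W.IsElliptic] (p : ℕ) [Fact p.Prime]

/-- **Kato's (14.9.3) count for all large levels.**  See the module docstring: `∃ k₀, ∀ k ≥ k₀`, for every Poitou–Tate family
at level `p^k` and every pair of Kato structures `𝓢 ≤ ℛ` on `E[p^k]`,
`#H¹_ℛ(K, E[p^k]) = #Sel_str^{ur}(K, E[p^∞]) · ∏_{v∈P} #𝓚_v` — granted finiteness of `Sel_str^{ur}(K,E[p^∞])` and a bound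
`p^{e_P}` on the local torsion `E(K_v)[p^∞]`, `v ∈ P`. [cite: Kato2004Asterisque, (14.9.3)–(14.9.4) (p. 240) and Prop. 14.16 (p. 244)]
[cite: GreenbergLNM1716, §3 Lemma 3.3 and §5 Prop. 5.8] -/
theorem exists_forall_le_natCard_selmerGroup_relaxed_eq (hodd : p ≠ 2) (P T : Finset (HeightOneSpectrum (𝓞 K)))
    (hPT : P ⊆ T) (hT : ∀ v : HeightOneSpectrum (𝓞 K), v ∉ T → (p : 𝓞 K) ∉ v.asIdeal ∧ W.HasGoodReductionAt v)
    (hPp : ∀ v : HeightOneSpectrum (𝓞 K), (p : 𝓞 K) ∈ v.asIdeal → v ∈ P)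
    (𝓢inf : SelmerStructure (primaryGaloisModule W p)) [Finite 𝓢inf.selmerGroup]
    (hIP : ∀ v ∈ P, 𝓢inf (Sum.inr v) = ⊥)
    (hIur : ∀ v ∉ P, 𝓢inf (Sum.inr v) = unramifiedSubgroup (GaloisRep.toLocal v (primaryGaloisModule W p)) 1)
    (hIinl : ∀ w : InfinitePlace K, 𝓢inf (Sum.inl w) = ⊤)
    (heP : ∃ eP : ℕ, ∀ v ∈ P, ∀ x : W.geomPrimaryTorsion p,
      (∀ σ : absoluteGaloisGroup (v.adicCompletion K), GaloisRep.toLocal v (primaryGaloisModule W p) σ x = x) →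
        p ^ eP • x = 0)
    {v₀ : HeightOneSpectrum (𝓞 K)} (hv₀P : v₀ ∈ P) :
    ∃ k₀ : ℕ, ∀ k, k₀ ≤ k →
      ∀ (inv : LocalInvariants K (p ^ k)), inv.IsPerfect → inv.SumLocalTermEqZero → inv.SelmerComplement →
      ∀ (𝓢 ℛ : SelmerStructure (W.torsionGaloisModule ((p ^ k : ℕ) : ℤ))),
        (∀ v ∈ P, 𝓢 (Sum.inr v) = ⊥) → (∀ v ∈ P, ℛ (Sum.inr v) = ⊤) →
        (∀ v ∉ P, 𝓢 (Sum.inr v) = unramifiedSubgroup (GaloisRep.toLocal v (W.torsionGaloisModule ((p ^ k : ℕ) : ℤ))) 1) →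
        (∀ v ∉ P, ℛ (Sum.inr v) = unramifiedSubgroup (GaloisRep.toLocal v (W.torsionGaloisModule ((p ^ k : ℕ) : ℤ))) 1) →
        Nat.card ℛ.selmerGroup =
          Nat.card 𝓢inf.selmerGroup * ∏ v ∈ P, Nat.card (W.kummerSelmerStructure ((p ^ k : ℕ) : ℤ) (Sum.inr v)) := by
  -- the exponent of the finite group `Sel_str^{ur}`
  obtain ⟨m, -, hm⟩ := exists_pow_nsmul_eq_zero_of_finite (W := W) (p := p) 𝓢inf.selmerGroup
  -- `E[p^k]` is unramified off `T`; `{v ∣ p^k} ⊆ P`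
  have hTur : ∀ (k : ℕ) (v : HeightOneSpectrum (𝓞 K)), v ∉ T →
      GaloisRep.IsUnramifiedAt v (W.torsionGaloisModule ((p ^ k : ℕ) : ℤ)) :=
    fun k v hv => isUnramifiedAt_torsionGaloisModule W (hT v hv).2 (intCast_pow_not_mem p (hT v hv).1 k)
  have hP : ∀ (k : ℕ) (v : HeightOneSpectrum (𝓞 K)), 1 ≤ k → ((p ^ k : ℕ) : 𝓞 K) ∈ v.asIdeal → v ∈ P := by
    intro k v _ hk
    refine hPp v (v.isPrime.mem_of_pow_mem k ?_)
    rwa [← Nat.cast_pow]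
  obtain ⟨e₁, he₁⟩ := exists_forall_natCard_selmerGroup_relaxed_eq W p hodd P T hPT hT hTur hP 𝓢inf hIP hIur hIinl hv₀P
  obtain ⟨eP, heP⟩ := heP
  refine ⟨m + max e₁ eP + 1, fun k hk => ?_⟩
  obtain ⟨e, rfl⟩ := Nat.exists_eq_add_of_le (show m ≤ k by omega)
  intro inv hperf hsum hcompl 𝓢 ℛ h𝓢P hℛP h𝓢ur hℛur
  have he : e₁ ≤ e := by omega
  have heP' : ∀ v ∈ P, ∀ x : W.geomPrimaryTorsion p,
      (∀ σ : absoluteGaloisGroup (v.adicCompletion K), GaloisRep.toLocal v (primaryGaloisModule W p) σ x = x) →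
        p ^ e • x = 0 := by
    intro v hv x hx
    have hle : eP ≤ e := by omega
    rw [← Nat.sub_add_cancel hle, pow_add, mul_smul, heP v hv x hx, smul_zero]
  exact he₁ e he m (by omega) hm heP' inv hperf hsum hcompl 𝓢 ℛ h𝓢P hℛP h𝓢ur hℛur

end Final

end Summit.BirchSwinnertonDyer.BirchSwinnertonDyer.Theorems.KatoFiniteLevelCount

end
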